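import Summits.QuantumFields.BalabanUV.T4Continuum.Support.NE7K1LinTwoRunFaces
import Summits.QuantumFields.BalabanUV.T4Continuum.Support.NE7K1LinSchurLineDerivU1
import Summits.QuantumFields.BalabanUV.T4Continuum.Support.NE7K1LinInvAntitone

/-!
# NE7K1LinTwoRunMonotone — row NE7 (node U5), candidate route HOM, path H1L, cell K1-lin(s): THE TWO-CUTOFF LINE IS
# LÖWNER-MONOTONE AT `A = 0` — coercivity `γ₀` for every `s` without loss, the propagator `G(s)` form-antitone in `s`, the
# INTEGRATED letter `‖(G(s) − G(t))g‖ ≤ ((1 − L⁻¹)∕γ₀)‖g‖`, and the Lipschitz letter `|t−s|·(L−1)∕γ₀` (`c₁ = 1`, `σ = γ₀`)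

Lineage `b2b-balaban-t4-ne7-p2` (CRUX PROVER NE7 #2), generation 65; corollaries of `NE7K1LinTwoRunJensen.runA_form_le_schurB_sharp`
(`P_A ⪯ P_B^{Schur}`) and `NE7K1LinTwoRunFaces.schurB_form_le_sharp` (`P_B^{Schur} ⪯ L·P_A`) (both this generation) — the
«Corollary (monotone two-cutoff line)» of lens 2's (K2)♯ supply (`HOME/t4/ideate/NE7/lens2-g26/K2-SHARP-JENSEN-SUPPLY.md` §1, graded
SOUND at PRICING-NE7 v18 §111 (d)), made kernel.  Objects of `NE7K1LinSchurLineU1`: `P_A = runA`, `P_B^{Schur} = twoCutoffLine 1`,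
`twoCutoffLine s = (1−s)P_A + s·P_B^{Schur}`, `G(s) = (twoCutoffLine s)⁻¹`, `γ₀ = min(2,a)` (run A's own (1.8)-floor,
`B4Lower18.lower18_zero`).  All [folklore]:

* abstract kit (`NE7K1LinInvAntitone`, filed with this file): `inv_form_antitone_smul` (`P ⪯ κQ ⇒ Q⁻¹ ⪯ κP⁻¹`),
  `inv_form_le_of_coercive` (`P ⪰ σ ⇒ P⁻¹ ⪯ σ⁻¹`), `mulVec_sq_le_of_psd` (form bound ⇒ norm bound for symmetric PSD).
* §1 the line at `A = 0` (`a > 0`, `n ≥ 1`, `R′` a union of `nL`-blocks):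
  **`runA_form_le_twoCutoffLine`** `⟨v,P_Av⟩ ≤ ⟨v, twoCutoffLine s·v⟩` (`0 ≤ s`); **`twoCutoffLine_form_mono`** `s ≤ t ⇒
  ⟨v,L(s)v⟩ ≤ ⟨v,L(t)v⟩`; **`twoCutoffLine_coercive_sharp`** `min(2,a)‖v‖² ≤ ⟨v,L(s)v⟩` for every `s ≥ 0` — NO `L^{−(d+1)}` loss and no
  ψ-rescaling (against `NE7K1LinSchurLineU1`'s floor `min(2,a)∕L^{d+1}` and `NE7K1LinSchurLineDerivU1`'s `c₁·min(2,a)`);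
  `twoCutoffLine_form_le` `⟨v,L(s)v⟩ ≤ L·⟨v,P_Av⟩` (`s ∈ [0,1]`).
* §2 the propagator: **`twoCutoff_inv_form_antitone`** `s ≤ t ⇒ ⟨g,G(t)g⟩ ≤ ⟨g,G(s)g⟩`; **`twoCutoff_inv_sub_form_le`**
  `0 ≤ ⟨g,(G(s) − G(t))g⟩ ≤ ((1 − L⁻¹)∕min(2,a))·‖g‖²` for `s ≤ t` in `[0,1]` (sandwich `G(1) ⪯ G(t) ⪯ G(s) ⪯ G(0) = P_A⁻¹`,
  `G(1) = (P_B^{Schur})⁻¹ ⪰ L⁻¹P_A⁻¹`, `P_A⁻¹ ⪯ γ₀⁻¹`); **`twoCutoff_inv_sub_sq_le`** — THE INTEGRATED LETTER —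
  `‖(G(s) − G(t))g‖² ≤ ((1 − L⁻¹)∕min(2,a))²·‖g‖²` for ALL `s, t ∈ [0,1]`: mesh-free, `s`-free, and WITHOUT the factor `|t−s|·L` of
  the Lipschitz letter; `twoCutoff_inv_sub_sq_le_uniform`: `≤ ‖g‖²∕min(2,a)²` — no `L` at all, so UNIFORM over refinement factors
  `L ↦ L^m` (any number of RG steps between the two runs); **`twoCutoff_inv_lipschitz_sharp`** `‖(G(s) − G(t))g‖² ≤ (t−s)²·((L−1)∕min(2,a))²·‖g‖²` (the letter of
  `NE7K1LinSchurLineDerivRel` fed with `c₁ = 1`, `σ = γ₀` and every squeeze constant `K > L − 1` (`twoCutoff_inv_lipschitz_of_gt`),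
  then `K ↓ L − 1`; `L = 1` admissible — against p293538's `L²∕(c₁²·min(2,a))`, `c₁ = (3((d+1)L²+1)L^{d−1})⁻¹`).

WHAT THIS SAYS for cell K1-lin(s) (lens 2's words, now kernel facts at `A = 0`): the two-cutoff line is Löwner-NONDECREASING, its
propagator NONINCREASING in `s`; `∂_sG ⪯ 0` has a SIGN; every constant is free of the mesh `n`, of `s, t` and of the region.

HONEST FRAMING: Gaussian `A = 0`, ONE RG step, finite regions, [folklore]; an INSTANCE, not Bałaban's (3.35) at general backgrounds
(licence item `NE7K1LinSchurLineInst` untouched); the comparison constants `(1, L)` are lens 2's (K2)♯ pair (sharp for the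
block-constant trial; the homogenised upper constant would be `O(1)` in `L`); nothing printed asserted; no `sorry`.  FIXED FINITE T⁴, rung (B)+1; NE7 NOT PRINTED ∕ NOT PROVED; spine 0∕9; NOT infinite
volume, NOT mass gap, NOT Clay.  HONEST DEPENDENCY: continuum YM on T⁴ ⇐ BetaPertH ∧ nine spine estimates (0/9 proved); BetaPertH ⇐
(D1) ∧ (D4) ∧ CAP+tail; G-an2-4 gates asym, D1 and NE2/3/4.
-/

noncomputable section

open Finset Matrix

namespace Summit.QuantumFields.BalabanUV.T4Continuum.NE7K1LinTwoRunMonotone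

open Literature.MathematicalPhysics.QuantumFieldTheory.Balaban1983to89
open Literature.MathematicalPhysics.QuantumFieldTheory.Balaban1983to89.B4Reflection242
open Literature.MathematicalPhysics.QuantumFieldTheory.Balaban1983to89.B4Lower18
open NE7K1LinSchurLineForm NE7K1LinBlockCoords NE7K1LinSchurLineU1 NE7K1LinTwoRunKit NE7K1LinTwoRunUpper
  NE7K1LinTwoRunLower NE7K1LinSchurLineDerivRel NE7K1LinSchurLineDerivU1 NE7K1LinTwoRunJensen NE7K1LinTwoRunFaces
  NE7K1LinInvAntitone

/-! ### §1 The two-cutoff line at `A = 0` is Löwner-nondecreasing and `γ₀`-coercive for every `s` -/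

section Line

variable {d n L : ℕ} [NeZero L] {R' : Finset (Fin (d + 1) → ℤ)}

/-- the line in terms of its endpoints: `twoCutoffLine s = (1−s)·P_A + s·P_B^{Schur}`. [folklore] -/
theorem twoCutoffLine_eq (hR'L : IsBlockUnion L R') (n : ℕ) (a s : ℝ) :
    twoCutoffLine hR'L n a s = (1 - s) • runA n L a R' + s • twoCutoffLine hR'L n a 1 := by
  rw [twoCutoffLine_one]
  rfl

/-- **`P_A ⪯ twoCutoffLine s`** for every `s ≥ 0` (`a > 0`, `n ≥ 1`, `R′` a union of `nL`-blocks). [folklore] -/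
theorem runA_form_le_twoCutoffLine (hn : 1 ≤ n) (hR' : IsBlockUnion (n * L) R') {a : ℝ} (ha : 0 < a) {s : ℝ} (hs : 0 ≤ s)
    (v : ↥(R'.image (blk L)) → ℝ) :
    v ⬝ᵥ (runA n L a R').mulVec v ≤ v ⬝ᵥ (twoCutoffLine (isBlockUnion_fine hR') n a s).mulVec v := by
  have h1 := runA_form_le_schurB_sharp hn hR' ha v
  rw [twoCutoffLine_eq (isBlockUnion_fine hR') n a s, add_mulVec, smul_mulVec, smul_mulVec, dotProduct_add,
    dotProduct_smul, dotProduct_smul, smul_eq_mul, smul_eq_mul]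
  nlinarith

/-- **THE TWO-CUTOFF LINE IS LÖWNER-NONDECREASING**: `s ≤ t ⇒ ⟨v, L(s)v⟩ ≤ ⟨v, L(t)v⟩`. [folklore] -/
theorem twoCutoffLine_form_mono (hn : 1 ≤ n) (hR' : IsBlockUnion (n * L) R') {a : ℝ} (ha : 0 < a) {s t : ℝ} (hst : s ≤ t)
    (v : ↥(R'.image (blk L)) → ℝ) :
    v ⬝ᵥ (twoCutoffLine (isBlockUnion_fine hR') n a s).mulVec v ≤ v ⬝ᵥ (twoCutoffLine (isBlockUnion_fine hR') n a t).mulVec v := by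
  have h1 := runA_form_le_schurB_sharp hn hR' ha v
  rw [twoCutoffLine_eq (isBlockUnion_fine hR') n a s, twoCutoffLine_eq (isBlockUnion_fine hR') n a t]
  simp only [add_mulVec, smul_mulVec, dotProduct_add, dotProduct_smul, smul_eq_mul]
  nlinarith

/-- **COERCIVITY `γ₀ = min(2,a)` OF THE LINE FOR EVERY `s ≥ 0`, WITHOUT LOSS**: `min(2,a)‖v‖² ≤ ⟨v, twoCutoffLine s·v⟩` — run A's own
(1.8)-floor, inherited by monotonicity (no `L^{−(d+1)}`, no ψ-rescaling, no `c₁`). [folklore] -/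
theorem twoCutoffLine_coercive_sharp (hn : 1 ≤ n) (hR' : IsBlockUnion (n * L) R') {a : ℝ} (ha : 0 < a) {s : ℝ} (hs : 0 ≤ s)
    (v : ↥(R'.image (blk L)) → ℝ) :
    min 2 a * (v ⬝ᵥ v) ≤ v ⬝ᵥ (twoCutoffLine (isBlockUnion_fine hR') n a s).mulVec v :=
  (lower18_zero hn ha.le (isBlockUnion_coarse NeZero.one_le hR') v).trans (runA_form_le_twoCutoffLine hn hR' ha hs v)

/-- the line is below `L·P_A` on `[0,1]` (`NE7K1LinTwoRunFaces.schurB_form_le_sharp`). [folklore] -/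
theorem twoCutoffLine_form_le (hn : 1 ≤ n) (hR' : IsBlockUnion (n * L) R') {a : ℝ} (ha : 0 < a) {s : ℝ} (hs0 : 0 ≤ s)
    (hs1 : s ≤ 1) (v : ↥(R'.image (blk L)) → ℝ) :
    v ⬝ᵥ (twoCutoffLine (isBlockUnion_fine hR') n a s).mulVec v ≤ (L : ℝ) * (v ⬝ᵥ (runA n L a R').mulVec v) := by
  have h1 := schurB_form_le_sharp hn hR' ha v
  have h0 : 0 ≤ v ⬝ᵥ (runA n L a R').mulVec v :=
    le_trans (mul_nonneg (lt_min (by norm_num) ha).le ((Finset.sum_nonneg fun i _ => mul_self_nonneg (v i))))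
      (lower18_zero hn ha.le (isBlockUnion_coarse NeZero.one_le hR') v)
  have hL1 : (1 : ℝ) ≤ (L : ℝ) := by exact_mod_cast (NeZero.one_le : 1 ≤ L)
  rw [twoCutoffLine_eq (isBlockUnion_fine hR') n a s]
  simp only [add_mulVec, smul_mulVec, dotProduct_add, dotProduct_smul, smul_eq_mul]
  nlinarith [mul_le_mul_of_nonneg_left h1 hs0, mul_nonneg (sub_nonneg.2 hs1) h0,
    mul_le_mul_of_nonneg_right hL1 h0]

/-- the line is a symmetric matrix. [folklore] -/
theorem twoCutoffLine_isSymm (hR'L : IsBlockUnion L R') (n : ℕ) (a s : ℝ) : (twoCutoffLine hR'L n a s).IsSymm := by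
  rw [twoCutoffLine_eq hR'L n a s, twoCutoffLine_one]
  exact ((fineOpR_isSymm n a 0 _).smul (1 - s)).add ((schurB_isSymm hR'L n a).smul s)

end Line

/-! ### §2 The propagator: antitone in `s`, the integrated letter, the sharp Lipschitz letter -/

section Propagator

variable {d n L : ℕ} [NeZero L] {R' : Finset (Fin (d + 1) → ℤ)}

/-- **THE TWO-CUTOFF PROPAGATOR IS FORM-ANTITONE IN `s`**: `0 ≤ s ≤ t ⇒ ⟨g, G(t)g⟩ ≤ ⟨g, G(s)g⟩`, `G(s) = (twoCutoffLine s)⁻¹`.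
[folklore] -/
theorem twoCutoff_inv_form_antitone (hn : 1 ≤ n) (hR' : IsBlockUnion (n * L) R') {a : ℝ} (ha : 0 < a) {s t : ℝ}
    (hs : 0 ≤ s) (hst : s ≤ t) (g : ↥(R'.image (blk L)) → ℝ) :
    g ⬝ᵥ (twoCutoffLine (isBlockUnion_fine hR') n a t)⁻¹.mulVec g ≤
      g ⬝ᵥ (twoCutoffLine (isBlockUnion_fine hR') n a s)⁻¹.mulVec g :=
  inv_form_antitone _ _ (twoCutoffLine_isSymm _ n a s) (lt_min (by norm_num) ha)
    (fun w => twoCutoffLine_coercive_sharp hn hR' ha hs w) (fun w => twoCutoffLine_form_mono hn hR' ha hst w) g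

/-- **THE SANDWICH**: for `0 ≤ s ≤ t ≤ 1`, `0 ≤ ⟨g,(G(s) − G(t))g⟩ ≤ ((1 − L⁻¹)∕min(2,a))·‖g‖²` — `G(1) ⪯ G(t) ⪯ G(s) ⪯ G(0) = P_A⁻¹`,
`G(1) = (P_B^{Schur})⁻¹ ⪰ L⁻¹·P_A⁻¹`, `P_A⁻¹ ⪯ min(2,a)⁻¹`. [folklore] -/
theorem twoCutoff_inv_sub_form_le (hn : 1 ≤ n) (hR' : IsBlockUnion (n * L) R') {a : ℝ} (ha : 0 < a) {s t : ℝ}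
    (hs0 : 0 ≤ s) (hst : s ≤ t) (ht1 : t ≤ 1) (g : ↥(R'.image (blk L)) → ℝ) :
    0 ≤ g ⬝ᵥ ((twoCutoffLine (isBlockUnion_fine hR') n a s)⁻¹ - (twoCutoffLine (isBlockUnion_fine hR') n a t)⁻¹).mulVec g ∧
      g ⬝ᵥ ((twoCutoffLine (isBlockUnion_fine hR') n a s)⁻¹ - (twoCutoffLine (isBlockUnion_fine hR') n a t)⁻¹).mulVec g ≤
        (1 - (L : ℝ)⁻¹) / min 2 a * (g ⬝ᵥ g) := by
  have hL : 1 ≤ L := NeZero.one_le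
  have hRc : IsBlockUnion n (R'.image (blk L)) := isBlockUnion_coarse hL hR'
  have hmin : 0 < min 2 a := lt_min (by norm_num) ha
  have hL0 : (0 : ℝ) < (L : ℝ) := by exact_mod_cast hL
  rw [sub_mulVec, dotProduct_sub]
  refine ⟨by linarith [twoCutoff_inv_form_antitone hn hR' ha hs0 hst g], ?_⟩
  -- `G(s) ⪯ G(0) = P_A⁻¹` and `G(1) ⪯ G(t)`
  have h0 := twoCutoff_inv_form_antitone hn hR' ha le_rfl hs0 g
  have h1 := twoCutoff_inv_form_antitone hn hR' ha (hs0.trans hst) ht1 g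
  rw [twoCutoffLine_zero] at h0
  -- `P_A⁻¹ ⪯ min(2,a)⁻¹`
  have hA := (inv_form_le_of_coercive (runA n L a R') hmin (fun w => lower18_zero hn ha.le hRc w) g).2
  -- `(P_B^{Schur})⁻¹ ⪰ L⁻¹·P_A⁻¹` from `P_B^{Schur} ⪯ L·P_A`
  have hB : g ⬝ᵥ (runA n L a R')⁻¹.mulVec g ≤ (L : ℝ) * (g ⬝ᵥ (twoCutoffLine (isBlockUnion_fine hR') n a 1)⁻¹.mulVec g) :=
    inv_form_antitone_smul _ _ (twoCutoffLine_isSymm _ n a 1) hmin hL0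
      (fun w => twoCutoffLine_coercive_sharp hn hR' ha zero_le_one w) (fun w => schurB_form_le_sharp hn hR' ha w) g
  have hB' : (L : ℝ)⁻¹ * (g ⬝ᵥ (runA n L a R')⁻¹.mulVec g) ≤
      g ⬝ᵥ (twoCutoffLine (isBlockUnion_fine hR') n a 1)⁻¹.mulVec g := by
    rw [inv_mul_le_iff₀ hL0]; exact hB
  have hgg : 0 ≤ g ⬝ᵥ g := Finset.sum_nonneg fun i _ => mul_self_nonneg (g i)
  have hApos := (inv_form_le_of_coercive (runA n L a R') hmin (fun w => lower18_zero hn ha.le hRc w) g).1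
  have hcoef : 0 ≤ 1 - (L : ℝ)⁻¹ := by
    rw [sub_nonneg]; exact inv_le_one_of_one_le₀ (by exact_mod_cast hL)
  calc g ⬝ᵥ (twoCutoffLine (isBlockUnion_fine hR') n a s)⁻¹.mulVec g -
        g ⬝ᵥ (twoCutoffLine (isBlockUnion_fine hR') n a t)⁻¹.mulVec g
      ≤ g ⬝ᵥ (runA n L a R')⁻¹.mulVec g - (L : ℝ)⁻¹ * (g ⬝ᵥ (runA n L a R')⁻¹.mulVec g) := by linarith
    _ = (1 - (L : ℝ)⁻¹) * (g ⬝ᵥ (runA n L a R')⁻¹.mulVec g) := by ring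
    _ ≤ (1 - (L : ℝ)⁻¹) * ((g ⬝ᵥ g) / min 2 a) := mul_le_mul_of_nonneg_left hA hcoef
    _ = (1 - (L : ℝ)⁻¹) / min 2 a * (g ⬝ᵥ g) := by ring

/-- **THE INTEGRATED LETTER**: for ALL `s, t ∈ [0,1]` and every `g`,
`‖(G(s) − G(t))g‖² ≤ ((1 − L⁻¹)∕min(2,a))²·‖g‖²` — mesh-free, `s`-free, region-free, and without the `|t−s|·L` of the
Lipschitz letter. [folklore] -/
theorem twoCutoff_inv_sub_sq_le (hn : 1 ≤ n) (hR' : IsBlockUnion (n * L) R') {a : ℝ} (ha : 0 < a) {s t : ℝ}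
    (hs0 : 0 ≤ s) (hs1 : s ≤ 1) (ht0 : 0 ≤ t) (ht1 : t ≤ 1) (g : ↥(R'.image (blk L)) → ℝ) :
    ((twoCutoffLine (isBlockUnion_fine hR') n a s)⁻¹ - (twoCutoffLine (isBlockUnion_fine hR') n a t)⁻¹).mulVec g ⬝ᵥ
        ((twoCutoffLine (isBlockUnion_fine hR') n a s)⁻¹ - (twoCutoffLine (isBlockUnion_fine hR') n a t)⁻¹).mulVec g ≤
      ((1 - (L : ℝ)⁻¹) / min 2 a) ^ 2 * (g ⬝ᵥ g) := by
  have hL : 1 ≤ L := NeZero.one_le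
  have hmin : 0 < min 2 a := lt_min (by norm_num) ha
  have hcoef : 0 ≤ (1 - (L : ℝ)⁻¹) / min 2 a :=
    div_nonneg (by rw [sub_nonneg]; exact inv_le_one_of_one_le₀ (by exact_mod_cast hL)) hmin.le
  have hsymm : ∀ s' t' : ℝ, ((twoCutoffLine (isBlockUnion_fine hR') n a s')⁻¹ -
      (twoCutoffLine (isBlockUnion_fine hR') n a t')⁻¹).IsSymm := fun s' t' =>
    (twoCutoffLine_isSymm _ n a s').inv.sub (twoCutoffLine_isSymm _ n a t').inv
  -- the case `s ≤ t`; the other by antisymmetry of the difference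
  have key : ∀ s' t' : ℝ, 0 ≤ s' → s' ≤ t' → t' ≤ 1 →
      ((twoCutoffLine (isBlockUnion_fine hR') n a s')⁻¹ - (twoCutoffLine (isBlockUnion_fine hR') n a t')⁻¹).mulVec g ⬝ᵥ
        ((twoCutoffLine (isBlockUnion_fine hR') n a s')⁻¹ - (twoCutoffLine (isBlockUnion_fine hR') n a t')⁻¹).mulVec g ≤
      ((1 - (L : ℝ)⁻¹) / min 2 a) ^ 2 * (g ⬝ᵥ g) := by
    intro s' t' hs' hst' ht'
    exact mulVec_sq_le_of_psd _ (hsymm s' t') (fun w => (twoCutoff_inv_sub_form_le hn hR' ha hs' hst' ht' w).1) hcoef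
      (fun w => (twoCutoff_inv_sub_form_le hn hR' ha hs' hst' ht' w).2) g
  rcases le_total s t with hst | hts
  · exact key s t hs0 hst ht1
  · have e : ((twoCutoffLine (isBlockUnion_fine hR') n a s)⁻¹ - (twoCutoffLine (isBlockUnion_fine hR') n a t)⁻¹).mulVec g =
        -(((twoCutoffLine (isBlockUnion_fine hR') n a t)⁻¹ - (twoCutoffLine (isBlockUnion_fine hR') n a s)⁻¹).mulVec g) := by
      rw [← neg_mulVec, neg_sub]
    rw [e, neg_dotProduct, dotProduct_neg, neg_neg]
    exact key t s ht0 hts hs1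

/-- **THE INTEGRATED LETTER, UNIFORM IN THE REFINEMENT FACTOR**: for ALL `s, t ∈ [0,1]`, every `g` and EVERY `L ≥ 1`,
`‖(G(s) − G(t))g‖² ≤ ‖g‖²∕min(2,a)²` — no `L` at all; since `L` is arbitrary (in particular `L ↦ L^m`, any number of RG steps
between the two runs, `R′` a union of `nL^m`-blocks), run A's propagator and the Schur-complemented propagator of ANY finer run on
the same region differ by at most `1∕γ₀` in operator norm, uniformly in the mesh and in the number of steps. [folklore] -/
theorem twoCutoff_inv_sub_sq_le_uniform (hn : 1 ≤ n) (hR' : IsBlockUnion (n * L) R') {a : ℝ} (ha : 0 < a) {s t : ℝ}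
    (hs0 : 0 ≤ s) (hs1 : s ≤ 1) (ht0 : 0 ≤ t) (ht1 : t ≤ 1) (g : ↥(R'.image (blk L)) → ℝ) :
    ((twoCutoffLine (isBlockUnion_fine hR') n a s)⁻¹ - (twoCutoffLine (isBlockUnion_fine hR') n a t)⁻¹).mulVec g ⬝ᵥ
        ((twoCutoffLine (isBlockUnion_fine hR') n a s)⁻¹ - (twoCutoffLine (isBlockUnion_fine hR') n a t)⁻¹).mulVec g ≤
      (g ⬝ᵥ g) / (min 2 a) ^ 2 := by
  have hL : 1 ≤ L := NeZero.one_le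
  have hmin : 0 < min 2 a := lt_min (by norm_num) ha
  have hgg : 0 ≤ g ⬝ᵥ g := Finset.sum_nonneg fun i _ => mul_self_nonneg (g i)
  have h := twoCutoff_inv_sub_sq_le hn hR' ha hs0 hs1 ht0 ht1 g
  have hc1 : (1 - (L : ℝ)⁻¹) / min 2 a ≤ 1 / min 2 a :=
    div_le_div_of_nonneg_right (by linarith [inv_nonneg.2 (Nat.cast_nonneg (α := ℝ) L)]) hmin.le
  have hc0 : 0 ≤ (1 - (L : ℝ)⁻¹) / min 2 a :=
    div_nonneg (by rw [sub_nonneg]; exact inv_le_one_of_one_le₀ (by exact_mod_cast hL)) hmin.le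
  have hsq : ((1 - (L : ℝ)⁻¹) / min 2 a) ^ 2 ≤ (1 / min 2 a) ^ 2 := pow_le_pow_left₀ hc0 hc1 2
  calc _ ≤ ((1 - (L : ℝ)⁻¹) / min 2 a) ^ 2 * (g ⬝ᵥ g) := h
    _ ≤ (1 / min 2 a) ^ 2 * (g ⬝ᵥ g) := mul_le_mul_of_nonneg_right hsq hgg
    _ = (g ⬝ᵥ g) / (min 2 a) ^ 2 := by field_simp

/-- the Lipschitz letter for every admissible squeeze constant `K > L − 1` (`NE7K1LinSchurLineDerivRel.lineOpR_inv_sub_inv_rel` with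
`c₁ = 1`, `σ = γ₀ = min(2,a)`, and `0 ⪯ P_B^{Schur} − P_A ⪯ (L−1)·P_A ⪯ K·P_A`). [folklore] -/
theorem twoCutoff_inv_lipschitz_of_gt (hn : 1 ≤ n) (hR' : IsBlockUnion (n * L) R') {a : ℝ} (ha : 0 < a) {K : ℝ}
    (hK : (L : ℝ) - 1 < K) {s t : ℝ} (hs0 : 0 ≤ s) (hs1 : s ≤ 1) (ht0 : 0 ≤ t) (ht1 : t ≤ 1) (g : ↥(R'.image (blk L)) → ℝ) :
    ((twoCutoffLine (isBlockUnion_fine hR') n a s)⁻¹ - (twoCutoffLine (isBlockUnion_fine hR') n a t)⁻¹).mulVec g ⬝ᵥ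
        ((twoCutoffLine (isBlockUnion_fine hR') n a s)⁻¹ - (twoCutoffLine (isBlockUnion_fine hR') n a t)⁻¹).mulVec g ≤
      (t - s) ^ 2 * (K / min 2 a) ^ 2 * (g ⬝ᵥ g) := by
  have hL : 1 ≤ L := NeZero.one_le
  have hL1 : (1 : ℝ) ≤ (L : ℝ) := by exact_mod_cast hL
  have hKpos : 0 < K := lt_of_le_of_lt (by linarith) hK
  have hR'L : IsBlockUnion L R' := isBlockUnion_fine hR'
  have hRc : IsBlockUnion n (R'.image (blk L)) := isBlockUnion_coarse hL hR'
  have hmin : 0 < min 2 a := lt_min (by norm_num) ha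
  set H := runB hR'L n a with hH
  have hP₀ : ∀ v, min 2 a * (v ⬝ᵥ v) ≤ v ⬝ᵥ (runA n L a R').mulVec v := fun v => lower18_zero hn ha.le hRc v
  have hP₀nn : ∀ v, 0 ≤ v ⬝ᵥ (runA n L a R').mulVec v := fun v =>
    le_trans (mul_nonneg hmin.le ((Finset.sum_nonneg fun i _ => mul_self_nonneg (v i)))) (hP₀ v)
  have hlow' : ∀ v, 1 * (v ⬝ᵥ (runA n L a R').mulVec v) ≤ v ⬝ᵥ (twoCutoffLine hR'L n a 1).mulVec v := fun v => by
    rw [one_mul]; exact runA_form_le_schurB_sharp hn hR' ha v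
  have hup' : ∀ v, v ⬝ᵥ (twoCutoffLine hR'L n a 1).mulVec v ≤ (L : ℝ) * (v ⬝ᵥ (runA n L a R').mulVec v) :=
    fun v => schurB_form_le_sharp hn hR' ha v
  simp only [twoCutoffLine_one] at hlow' hup'
  have hP₁ : ∀ v, min 2 a * (v ⬝ᵥ v) ≤
      v ⬝ᵥ (H.toBlocks₁₁ - H.toBlocks₁₂ * (H.toBlocks₂₂)⁻¹ * H.toBlocks₂₁).mulVec v := by
    intro v
    have h1 := hlow' v
    rw [one_mul] at h1
    exact (hP₀ v).trans h1
  have hup : ∀ v, v ⬝ᵥ (H.toBlocks₁₁ - H.toBlocks₁₂ * (H.toBlocks₂₂)⁻¹ * H.toBlocks₂₁).mulVec v -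
      v ⬝ᵥ (runA n L a R').mulVec v ≤ K * (v ⬝ᵥ (runA n L a R').mulVec v) := by
    intro v
    have h1 := hup' v; have h2 := hP₀nn v
    nlinarith [mul_le_mul_of_nonneg_right hK.le h2]
  have hlo : ∀ v, v ⬝ᵥ (runA n L a R').mulVec v -
      v ⬝ᵥ (H.toBlocks₁₁ - H.toBlocks₁₂ * (H.toBlocks₂₂)⁻¹ * H.toBlocks₂₁).mulVec v ≤
      K * (v ⬝ᵥ (runA n L a R').mulVec v) := by
    intro v
    have h1 := hlow' v; have h2 := hP₀nn v
    rw [one_mul] at h1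
    nlinarith [mul_nonneg hKpos.le h2]
  have main := lineOpR_inv_sub_inv_rel (runA n L a R') H.toBlocks₁₁ H.toBlocks₁₂ H.toBlocks₂₁ H.toBlocks₂₂
    (fineOpR_isSymm n a 0 _) (schurB_isSymm hR'L n a) hmin one_pos le_rfl hKpos hP₀ hP₁ hlow' hup hlo hs0 hs1 ht0 ht1 g
  rw [one_mul] at main
  exact main

/-- **THE LIPSCHITZ LETTER WITH `c₁ = 1`, `σ = γ₀`, `K − 1 = L − 1`**: for all `s, t ∈ [0,1]` and every `g`,
`‖(G(s) − G(t))g‖² ≤ (t−s)²·((L−1)∕min(2,a))²·‖g‖²` — the constant `(K−1)∕γ₀` of PRICING-NE7 v20.1 §133 (b) (m5) ∕ P-v21-1 at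
`K = L`; `L = 1` admissible (then both sides vanish: the two runs coincide).  Obtained from `twoCutoff_inv_lipschitz_of_gt` by letting
the squeeze constant decrease to `L − 1`.  Against p293538's `L²∕(c₁²·min(2,a))`, `c₁ = (3((d+1)L²+1)L^{d−1})⁻¹`. [folklore] -/
theorem twoCutoff_inv_lipschitz_sharp (hn : 1 ≤ n) (hR' : IsBlockUnion (n * L) R') {a : ℝ} (ha : 0 < a)
    {s t : ℝ} (hs0 : 0 ≤ s) (hs1 : s ≤ 1) (ht0 : 0 ≤ t) (ht1 : t ≤ 1) (g : ↥(R'.image (blk L)) → ℝ) :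
    ((twoCutoffLine (isBlockUnion_fine hR') n a s)⁻¹ - (twoCutoffLine (isBlockUnion_fine hR') n a t)⁻¹).mulVec g ⬝ᵥ
        ((twoCutoffLine (isBlockUnion_fine hR') n a s)⁻¹ - (twoCutoffLine (isBlockUnion_fine hR') n a t)⁻¹).mulVec g ≤
      (t - s) ^ 2 * (((L : ℝ) - 1) / min 2 a) ^ 2 * (g ⬝ᵥ g) := by
  have hL : 1 ≤ L := NeZero.one_le
  have hL1 : (0 : ℝ) ≤ (L : ℝ) - 1 := by rw [sub_nonneg]; exact_mod_cast hL
  have hmin : 0 < min 2 a := lt_min (by norm_num) ha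
  have hgg : 0 ≤ g ⬝ᵥ g := Finset.sum_nonneg fun i _ => mul_self_nonneg (g i)
  set c : ℝ := (t - s) ^ 2 * (g ⬝ᵥ g) / (min 2 a) ^ 2 with hc
  have hc0 : 0 ≤ c := by positivity
  -- for every `K > L − 1`: `LHS ≤ c·K²`
  have hK : ∀ K : ℝ, (L : ℝ) - 1 < K → ((twoCutoffLine (isBlockUnion_fine hR') n a s)⁻¹ -
      (twoCutoffLine (isBlockUnion_fine hR') n a t)⁻¹).mulVec g ⬝ᵥ ((twoCutoffLine (isBlockUnion_fine hR') n a s)⁻¹ -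
      (twoCutoffLine (isBlockUnion_fine hR') n a t)⁻¹).mulVec g ≤ c * K ^ 2 := by
    intro K hK'
    have h := twoCutoff_inv_lipschitz_of_gt hn hR' ha hK' hs0 hs1 ht0 ht1 g
    have e : (t - s) ^ 2 * (K / min 2 a) ^ 2 * (g ⬝ᵥ g) = c * K ^ 2 := by
      rw [hc]; field_simp
    linarith [e.le]
  have egoal : (t - s) ^ 2 * (((L : ℝ) - 1) / min 2 a) ^ 2 * (g ⬝ᵥ g) = c * ((L : ℝ) - 1) ^ 2 := by
    rw [hc]; field_simp
  rw [egoal]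
  refine le_of_forall_pos_le_add fun ε hε => ?_
  rcases hc0.eq_or_lt with h0 | hcpos
  · -- `c = 0`: every bound vanishes
    have h := hK ((L : ℝ) - 1 + 1) (by linarith)
    rw [← h0, zero_mul] at h ⊢
    linarith
  · -- `K := √((L−1)² + ε∕c) > L − 1` and `c·K² = c(L−1)² + ε`
    set K : ℝ := Real.sqrt (((L : ℝ) - 1) ^ 2 + ε / c) with hKdef
    have hpos : 0 < ε / c := div_pos hε hcpos
    have hKgt : (L : ℝ) - 1 < K := by
      rw [hKdef, Real.lt_sqrt hL1]
      linarith
    have hK2 : K ^ 2 = ((L : ℝ) - 1) ^ 2 + ε / c := by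
      rw [hKdef, Real.sq_sqrt (by positivity)]
    have h := hK K hKgt
    rw [hK2, mul_add, mul_div_cancel₀ _ hcpos.ne'] at h
    exact h

end Propagator

end Summit.QuantumFields.BalabanUV.T4Continuum.NE7K1LinTwoRunMonotone
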